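import Mathlib
import Summits.RiemannHypothesis.RiemannHypothesis.Theorems.SoloInformedVerifiedWindow
import HarnessLib

/-!
# The verified-height split with the verified Gram form KEPT (handoff prove-1, ATTEMPT-15, «THEOREM V»)

Solo's T42 (`SoloInformedVerifiedWindow`, `weilQuadratic_re_ge_of_rhUpTo`) splits the
autocorrelation `K = g ⋆ g̃` of a window test `g` (support `[-a, a]`) as `K ⋆ φ + (K - K ⋆ φ)`,
`φ = ψc ⋆ ψ̃c` for a mollifier profile `ψ` of radius `δ`, reads the low part on the ZERO side and
the high part on the PRIME side of the explicit formula, and concludes `Re W(g ⋆ g̃) ≥ -τ ‖g‖₂²`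
under `RHUpTo T₀`.  In that assembly two non-negative quantities are DROPPED:

* the **verified Gram form** `𝒱(g) = Σ_{ρ ∈ weilZeroIndex T₀} m(ρ) |ĝ(1/2 + iγ)|² |ψ̂(1/2 + iγ)|²`
  (the on-line terms of the low part, `verifiedGram`), and
* the **high-mass margin** `c · M₂(g)`, `M₂ = (2π)⁻¹ ∫ |ĝ|² (1 - |ψ̂|²)` (`highMass`), available as
  soon as the height `h` is chosen with `log π + 2 S(2a + 2δ) + c ≤ Re ψ(1/4 + ih/2)` instead of
  T42's `c = 0`.

Keeping both gives (`weilQuadratic_re_ge_verifiedGram`)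

  `Re W(g ⋆ g̃) ≥ 𝒱(g) + c · M₂(g) - τ ‖g‖₂²`   (`τ = verifiedTariff ψ a δ T₀ h k`),

and hence the REDUCTION (`weilPositivityOn_of_rhUpTo_of_nearNullSampling`): Weil positivity on
the window `[-a, a]` follows from `RHUpTo T₀` and the single RH-free inequality
`NearNullSampling`: `τ ‖g‖₂² ≤ 𝒱(g) + c · M₂(g)` for all window tests `g`.  The pair
`𝒱 + c M₂` has trivial kernel on every window (a test annihilating every verified zero — T73,
`SoloInformedFiniteRank` — carries high mass `M₂ ≈ ‖g‖₂²`), so the hypothesis is a quantitative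
statement about a positive-definite form built from the VERIFIED zeros and the archimedean
coercivity only.  Whether it holds for given `(a, ψ, T₀)` is a sampling question for
time-limited functions at the verified ordinates; it is NOT asserted here.  Nothing in this file
bears on the truth of RH: under `RiemannHypothesis` every statement below is implied by
`WeilPositivity.of_riemannHypothesis`.
-/

set_option linter.dupNamespace false

open scoped ContDiff ComplexConjugate Real Topology
open Complex MeasureTheory Set Filter Literature.NumberTheory.LFunctions
  Literature.Analysis.SpecialFunctions

namespace Summit.RiemannHypothesis.RiemannHypothesis.Theorems

variable {g : ℝ → ℂ} {ψ : ℝ → ℝ} {a δ : ℝ}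

/-! ### The verified Gram form -/

/-- The on-line density of the low part at height `γ`:
`G(γ) = |ĝ(1/2 + iγ)|² |ψ̂c(1/2 + iγ)|²` (`= Ĝ₁(1/2 + iγ)`, `weilMellin_lowPart_half_line`). -/
noncomputable def lowLineDensity (g : ℝ → ℂ) (ψ : ℝ → ℝ) (γ : ℝ) : ℝ :=
  ‖weilMellin g (1 / 2 + γ * I)‖ ^ 2 * ‖weilMellin (mollC ψ) (1 / 2 + γ * I)‖ ^ 2

/-- `G(γ) ≥ 0`. -/
theorem lowLineDensity_nonneg (g : ℝ → ℂ) (ψ : ℝ → ℝ) (γ : ℝ) : 0 ≤ lowLineDensity g ψ γ := by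
  unfold lowLineDensity; positivity

/-- The **verified Gram form** at height `T₀`:
`𝒱(g) = Σ_{ρ ∈ weilZeroIndex T₀} m(ρ) · |ĝ(1/2 + i Im ρ)|² |ψ̂c(1/2 + i Im ρ)|²`, a finite sum of
non-negative terms over the zeros of `ζ` with `0 ≤ Re ρ ≤ 1`, `0 < |Im ρ| ≤ T₀` (under `RHUpTo T₀`
these lie on the critical line, and the summand is the low-part term `m(ρ) Ĝ₁(ρ)` itself). -/
noncomputable def verifiedGram (g : ℝ → ℂ) (ψ : ℝ → ℝ) (T₀ : ℝ) : ℝ :=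
  ∑ᶠ ρ ∈ weilZeroIndex T₀, (riemannZetaZeroOrder ρ : ℝ) * lowLineDensity g ψ ρ.im

/-- `𝒱(g) ≥ 0`. -/
theorem verifiedGram_nonneg (g : ℝ → ℂ) (ψ : ℝ → ℝ) (T₀ : ℝ) : 0 ≤ verifiedGram g ψ T₀ := by
  unfold verifiedGram
  refine finsum_nonneg fun ρ ↦ finsum_nonneg fun hρ ↦ ?_
  have him : ρ.im ≠ 0 := hρ.2.2.2.1
  have hm0 : (0 : ℝ) ≤ riemannZetaZeroOrder ρ := by
    exact_mod_cast riemannZetaZeroOrder_nonneg (fun h ↦ him (by rw [h]; simp))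
  exact mul_nonneg hm0 (lowLineDensity_nonneg g ψ _)

/-! ### The low part with the verified terms kept -/

/-- **Low part, partial sums, verified terms kept.** Under `RHUpTo T₀`, `T₀ ≥ 1`, for every
`T ≥ T₀`: `Re Σ_{ρ ∈ weilZeroIndex T} m(ρ) Ĝ₁(ρ) ≥ 𝒱(g) - E` with Solo's `E = lowErr g ψ a T₀ k`
(the unverified zeros `|Im ρ| > T₀` are bounded absolutely by the strip decay of `φ̂`, exactly as in
`re_weilZeroSidePartial_lowPart_ge`; the verified ones are now COUNTED instead of dropped). -/
theorem re_weilZeroSidePartial_lowPart_ge_verifiedGram (hg : IsWeilTest g) (ha : 0 ≤ a)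
    (hsupp : tsupport g ⊆ Icc (-a) a) (hψ : IsMollifier ψ δ) {T₀ : ℝ} (hT₀ : 1 ≤ T₀)
    (hRH : RHUpTo T₀) (k : ℕ) {T : ℝ} (hT : T₀ ≤ T) :
    verifiedGram g ψ T₀ - lowErr g ψ a T₀ k ≤ (weilZeroSidePartial (lowPart g ψ) T).re := by
  set A : ℝ := Real.exp a * weilNorm1 g ^ 2 with hA
  set D : ℝ := weilL1 (deriv^[k + 1] (mollC ψ)) with hD
  have hA0 : 0 ≤ A := by positivity
  have hD0 : 0 ≤ D := weilL1_nonneg _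
  set M : ℝ := 2 * A * D ^ 2 / T₀ ^ (2 * k) with hM
  have hT₀pos : 0 < T₀ := by linarith
  have hM0 : 0 ≤ M := by positivity
  -- the majorant `F` of the unverified terms (verbatim from Solo's T42c)
  set F : ℂ → ℝ := fun ρ ↦ if T₀ < |ρ.im| then A * D ^ 2 / |ρ.im| ^ (2 * (k + 1)) else 0 with hF
  have hF0 : ∀ ρ, 0 ≤ F ρ := fun ρ ↦ by
    simp only [hF]; split_ifs <;> positivity
  have hFker : ∀ ρ : ℂ, 0 ≤ ρ.re → ρ.re ≤ 1 → F ρ ≤ M / (1 + (ρ.im - 0) ^ 2) := by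
    intro ρ _ _
    rw [sub_zero]
    simp only [hF]
    split_ifs with hγ
    · have hγpos : 0 < |ρ.im| := by linarith
      have hγ1 : 1 ≤ ρ.im ^ 2 := by
        rw [← sq_abs]; nlinarith
      rw [hM, div_le_div_iff₀ (by positivity) (by positivity)]
      have hpow : T₀ ^ (2 * k) ≤ |ρ.im| ^ (2 * k) :=
        pow_le_pow_left₀ hT₀pos.le hγ.le _
      have e : |ρ.im| ^ (2 * (k + 1)) = |ρ.im| ^ (2 * k) * ρ.im ^ 2 := by
        rw [show 2 * (k + 1) = 2 * k + 2 by ring, pow_add, sq_abs]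
      rw [e]
      have hX : 0 ≤ A * D ^ 2 := by positivity
      have hq : 1 ≤ |ρ.im| ^ (2 * k) / T₀ ^ (2 * k) := by
        rw [le_div_iff₀ (by positivity), one_mul]; exact hpow
      calc A * D ^ 2 * (1 + ρ.im ^ 2)
          ≤ A * D ^ 2 * (2 * ρ.im ^ 2) * (|ρ.im| ^ (2 * k) / T₀ ^ (2 * k)) := by
            have h1 : A * D ^ 2 * (1 + ρ.im ^ 2) ≤ A * D ^ 2 * (2 * ρ.im ^ 2) :=
              mul_le_mul_of_nonneg_left (by linarith) hX
            have h2 : 0 ≤ A * D ^ 2 * (2 * ρ.im ^ 2) := by positivity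
            nlinarith
        _ = 2 * A * D ^ 2 / T₀ ^ (2 * k) * (|ρ.im| ^ (2 * k) * ρ.im ^ 2) := by ring
    · positivity
  have hmaj := finsum_weilZeroIndex_le_of_kernel_bound_eff F M 0 hM0 hFker T
  rw [abs_zero, zero_add] at hmaj
  -- the kept part `P ρ = m(ρ) G(Im ρ)` on the verified zeros, `0` elsewhere
  set P : ℂ → ℝ := fun ρ ↦ if |ρ.im| ≤ T₀ then (riemannZetaZeroOrder ρ : ℝ) * lowLineDensity g ψ ρ.im
    else 0 with hP
  have hfin := weilZeroIndex_finite T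
  have hfin₀ := weilZeroIndex_finite T₀
  have hmem : ∀ ρ, ρ ∈ hfin.toFinset ↔ ρ ∈ weilZeroIndex T := fun ρ ↦ hfin.mem_toFinset
  have hmem₀ : ∀ ρ, ρ ∈ hfin₀.toFinset ↔ ρ ∈ weilZeroIndex T₀ := fun ρ ↦ hfin₀.mem_toFinset
  -- pointwise: `Re (m(ρ) Ĝ₁(ρ)) ≥ P ρ - m(ρ) F ρ`
  have hpt : ∀ ρ ∈ hfin.toFinset,
      P ρ - (riemannZetaZeroOrder ρ : ℝ) * F ρ ≤
        ((riemannZetaZeroOrder ρ : ℂ) * weilMellin (lowPart g ψ) ρ).re := by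
    intro ρ hρ
    obtain ⟨hz, h0, h1, him, _⟩ := (hmem ρ).1 hρ
    have hm0 : (0 : ℝ) ≤ riemannZetaZeroOrder ρ := by
      exact_mod_cast riemannZetaZeroOrder_nonneg (fun h ↦ him (by rw [h]; simp))
    rw [← Complex.ofReal_intCast, Complex.re_ofReal_mul]
    by_cases hγ : T₀ < |ρ.im|
    · -- unverified zero: absolute bound, `P ρ = 0`
      have hP' : P ρ = 0 := by simp only [hP, if_neg (not_le.2 hγ)]
      have hF' : F ρ = A * D ^ 2 / |ρ.im| ^ (2 * (k + 1)) := by simp only [hF, if_pos hγ]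
      have hn : ‖weilMellin (lowPart g ψ) ρ‖ ≤ A * D ^ 2 / |ρ.im| ^ (2 * (k + 1)) := by
        rw [weilMellin_lowPart hg hψ, norm_mul]
        have h1' := norm_weilMellin_autoCorr_strip_le hg ha hsupp h0 h1
        have h2' := hψ.norm_weilMellin_mollKernel_le (k + 1) h0 h1 him
        calc ‖weilMellin (autoCorr g) ρ‖ * ‖weilMellin (mollKernel ψ) ρ‖
            ≤ A * (D ^ 2 / |ρ.im| ^ (2 * (k + 1))) :=
              mul_le_mul h1' h2' (norm_nonneg _) hA0
          _ = A * D ^ 2 / |ρ.im| ^ (2 * (k + 1)) := by ring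
      have hre := neg_le_abs (weilMellin (lowPart g ψ) ρ).re
      have habs := Complex.abs_re_le_norm (weilMellin (lowPart g ψ) ρ)
      rw [hP', hF', zero_sub]
      nlinarith
    · -- verified zero: on the line, the term equals `m(ρ) G(Im ρ)`
      push Not at hγ
      have hre : ρ.re = 1 / 2 := hRH.re_eq hz him hγ
      have eρ : ρ = 1 / 2 + ρ.im * I := by
        apply Complex.ext <;> simp [hre]
      have hval : (weilMellin (lowPart g ψ) ρ).re = lowLineDensity g ψ ρ.im := by
        rw [eρ, weilMellin_lowPart_half_line hg hψ, Complex.ofReal_re]; simp [lowLineDensity]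
      have hP' : P ρ = (riemannZetaZeroOrder ρ : ℝ) * lowLineDensity g ψ ρ.im := by
        simp only [hP, if_pos hγ]
      have hF' : F ρ = 0 := by simp only [hF, if_neg (not_lt.2 hγ)]
      rw [hval, hP', hF', mul_zero, sub_zero]
  -- the kept part sums to `𝒱(g)`: the verified zeros of `weilZeroIndex T` are `weilZeroIndex T₀`
  have hPsum : ∑ ρ ∈ hfin.toFinset, P ρ = verifiedGram g ψ T₀ := by
    have hsplit : ∑ ρ ∈ hfin.toFinset, P ρ =
        ∑ ρ ∈ hfin.toFinset.filter (fun ρ ↦ |ρ.im| ≤ T₀),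
          (riemannZetaZeroOrder ρ : ℝ) * lowLineDensity g ψ ρ.im := by
      rw [Finset.sum_filter]
    have hset : hfin.toFinset.filter (fun ρ ↦ |ρ.im| ≤ T₀) = hfin₀.toFinset := by
      ext ρ
      rw [Finset.mem_filter, hmem, hmem₀]
      simp only [weilZeroIndex, mem_setOf_eq]
      constructor
      · rintro ⟨⟨hz, h0, h1, him, -⟩, hle⟩; exact ⟨hz, h0, h1, him, hle⟩
      · rintro ⟨hz, h0, h1, him, hle⟩; exact ⟨⟨hz, h0, h1, him, hle.trans hT⟩, hle⟩
    rw [hsplit, hset, verifiedGram, finsum_mem_eq_finite_toFinset_sum _ hfin₀]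
  -- sum up
  unfold weilZeroSidePartial
  rw [finsum_mem_eq_finite_toFinset_sum _ hfin, Complex.re_sum]
  rw [finsum_mem_eq_finite_toFinset_sum _ hfin] at hmaj
  have hsum := Finset.sum_le_sum hpt
  rw [Finset.sum_sub_distrib, hPsum] at hsum
  have hE : lowErr g ψ a T₀ k = 2 * zetaDensityConst * M * Real.log 2 := by
    rw [lowErr, hM]; ring
  rw [hE]
  linarith

/-- **Low part, verified terms kept.** Under `RHUpTo T₀`, `T₀ ≥ 1`:
`Re W(G₁) ≥ 𝒱(g) - E` (limit `T → ∞` of the previous bound through `explicit_formula_holds`). -/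
theorem weilFunctional_lowPart_re_ge_verifiedGram (hg : IsWeilTest g) (ha : 0 ≤ a)
    (hsupp : tsupport g ⊆ Icc (-a) a) (hψ : IsMollifier ψ δ) {T₀ : ℝ} (hT₀ : 1 ≤ T₀)
    (hRH : RHUpTo T₀) (k : ℕ) :
    verifiedGram g ψ T₀ - lowErr g ψ a T₀ k ≤ (weilFunctional (lowPart g ψ)).re := by
  have hG₁ := isWeilTest_lowPart hg hψ
  have hlim : Tendsto (fun T ↦ (weilZeroSidePartial (lowPart g ψ) T).re) atTop
      (𝓝 (weilFunctional (lowPart g ψ)).re) :=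
    (Complex.continuous_re.tendsto _).comp (explicit_formula_holds hG₁)
  exact ge_of_tendsto hlim ((eventually_ge_atTop T₀).mono fun T hT ↦
    re_weilZeroSidePartial_lowPart_ge_verifiedGram hg ha hsupp hψ hT₀ hRH k hT)

/-! ### The high part with a coercive margin -/

/-- **High part with margin.** If the height `h` satisfies
`log π + 2 S(2a + 2δ) + c ≤ Re ψ(1/4 + ih/2)` then
`Re W(G₂) ≥ c · M₂ - (W_h - W_0) δ² h² ‖g‖₂² - 2 (e^δ - 1) e^a ‖g‖₁²`
(Solo's T42b assembly with the margin `c · M₂` kept; no hypothesis on the zeros of `ζ`). -/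
theorem weilFunctional_highPart_re_ge_margin (hg : IsWeilTest g) (hsupp : tsupport g ⊆ Icc (-a) a)
    (hψ : IsMollifier ψ δ) {h c : ℝ}
    (hh : Real.log π + 2 * primeSum (2 * a + 2 * δ) + c ≤ reDigammaQuarter h) :
    c * highMass g ψ
        - (reDigammaQuarter h - reDigammaQuarter 0) * (δ ^ 2 * h ^ 2) * weilNorm2Sq g
        - 2 * (Real.exp δ - 1) * (Real.exp a * weilNorm1 g ^ 2) ≤
      (weilFunctional (highPart g ψ)).re := by
  set G := highPart g ψ with hG
  set M₂ := highMass g ψ with hM₂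
  set W := reDigammaQuarter h
  set w₀ := reDigammaQuarter 0
  have hM₂0 : 0 ≤ M₂ := highMass_nonneg hψ g
  have hπ : (0 : ℝ) < 2 * π := by positivity
  have hpol : -(2 * (Real.exp δ - 1) * (Real.exp a * weilNorm1 g ^ 2)) ≤ (weilPolarTerm G).re := by
    have h1 := norm_weilPolarTerm_highPart_le hg hsupp hψ
    have h2 := neg_le_abs (weilPolarTerm G).re
    have h3 := Complex.abs_re_le_norm (weilPolarTerm G)
    linarith
  have hpri : (weilPrimeTerm G).re ≤ 2 * M₂ * primeSum (2 * a + 2 * δ) := by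
    have h1 := norm_weilPrimeTerm_highPart_le hg hsupp hψ
    exact ((Complex.re_le_norm _)).trans h1
  have hstep := integral_mul_reDigammaQuarter_ge_step (fun t ↦ (highDensity_bounds hψ g t).1)
    (integrable_highDensity hg hψ) (integrable_highDensity_mul_reDigammaQuarter hg hψ) h
  have hlow := setIntegral_highDensity_le hg hψ h
  have hWw : 0 ≤ W - w₀ := by linarith [reDigammaQuarter_zero_le h]
  have hint : ∫ t, highDensity g ψ t = 2 * π * M₂ := by
    rw [hM₂, highMass, ← mul_assoc, mul_inv_cancel₀ hπ.ne', one_mul]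
  have harchI : 2 * π * (W * M₂ - (W - w₀) * (δ ^ 2 * h ^ 2) * weilNorm2Sq g) ≤
      (weilArchIntegral G).re := by
    rw [weilArchIntegral_highPart_re hg hψ]
    have : (W - w₀) * (∫ t in Ioo (-|h|) |h|, highDensity g ψ t) ≤
        (W - w₀) * (δ ^ 2 * h ^ 2 * (2 * π * weilNorm2Sq g)) :=
      mul_le_mul_of_nonneg_left hlow hWw
    rw [hint] at hstep
    linarith
  have hG0 : (G 0 * (Real.log π : ℂ)).re ≤ M₂ * Real.log π := by
    rw [Complex.re_mul_ofReal]
    refine mul_le_mul_of_nonneg_right ?_ (Real.log_nonneg (by linarith [Real.pi_gt_three]))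
    exact (Complex.re_le_norm _).trans (norm_highPart_le hg hψ 0)
  have harch : W * M₂ - (W - w₀) * (δ ^ 2 * h ^ 2) * weilNorm2Sq g - M₂ * Real.log π ≤
      (weilArchTerm G).re := by
    unfold weilArchTerm
    rw [Complex.sub_re]
    have e : ((1 / (2 * π) : ℂ) * weilArchIntegral G).re = 1 / (2 * π) * (weilArchIntegral G).re := by
      have : (1 / (2 * π) : ℂ) = ((1 / (2 * π) : ℝ) : ℂ) := by push_cast; ring
      rw [this, Complex.re_ofReal_mul]
    rw [e]
    have h3 : W * M₂ - (W - w₀) * (δ ^ 2 * h ^ 2) * weilNorm2Sq g ≤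
        1 / (2 * π) * (weilArchIntegral G).re := by
      rw [one_div, le_inv_mul_iff₀ hπ]; exact harchI
    linarith
  have hW : weilFunctional G = weilPolarTerm G - weilPrimeTerm G + weilArchTerm G := rfl
  rw [hW, Complex.add_re, Complex.sub_re]
  have hkey : c * M₂ ≤ M₂ * (W - Real.log π - 2 * primeSum (2 * a + 2 * δ)) := by
    have : c ≤ W - Real.log π - 2 * primeSum (2 * a + 2 * δ) := by linarith
    nlinarith
  nlinarith [hpol, hpri, harch, hkey]

/-! ### THEOREM V: the split with both non-negative forms kept -/

/-- **THEOREM V (raw form).** Under `RHUpTo T₀` (`T₀ ≥ 1`) and the infrared condition with margin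
`c`: `Re W(g ⋆ g̃) ≥ 𝒱(g) + c M₂(g) - E_low - (W_h - W_0) δ² h² ‖g‖₂² - 2(e^δ - 1) e^a ‖g‖₁²`. -/
theorem weilQuadratic_re_ge_verifiedGram_raw (hg : IsWeilTest g) (ha : 0 ≤ a)
    (hsupp : tsupport g ⊆ Icc (-a) a) (hψ : IsMollifier ψ δ) {T₀ : ℝ} (hT₀ : 1 ≤ T₀)
    (hRH : RHUpTo T₀) (k : ℕ) {h c : ℝ}
    (hh : Real.log π + 2 * primeSum (2 * a + 2 * δ) + c ≤ reDigammaQuarter h) :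
    verifiedGram g ψ T₀ + c * highMass g ψ - lowErr g ψ a T₀ k
        - (reDigammaQuarter h - reDigammaQuarter 0) * (δ ^ 2 * h ^ 2) * weilNorm2Sq g
        - 2 * (Real.exp δ - 1) * (Real.exp a * weilNorm1 g ^ 2) ≤ (weilQuadratic g).re := by
  have hG₁ := isWeilTest_lowPart hg hψ
  have hG₂ := isWeilTest_highPart hg hψ
  have hsplit : weilQuadratic g =
      weilFunctional (lowPart g ψ) + weilFunctional (highPart g ψ) := by
    rw [← weilFunctional_add hG₁ hG₂, lowPart_add_highPart]; rfl
  rw [hsplit, Complex.add_re]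
  have h1 := weilFunctional_lowPart_re_ge_verifiedGram hg ha hsupp hψ hT₀ hRH k
  have h2 := weilFunctional_highPart_re_ge_margin hg hsupp hψ hh
  linarith

/-- **THEOREM V (tariff form).** Under `RHUpTo T₀` (`T₀ ≥ 1`), `a > 0`, and the infrared
condition with margin `c`: `Re W(g ⋆ g̃) ≥ 𝒱(g) + c · M₂(g) - τ ‖g‖₂²` with Solo's verified tariff
`τ = verifiedTariff ψ a δ T₀ h k`. -/
theorem weilQuadratic_re_ge_verifiedGram (hg : IsWeilTest g) (ha : 0 < a)
    (hsupp : tsupport g ⊆ Icc (-a) a) (hψ : IsMollifier ψ δ) {T₀ : ℝ} (hT₀ : 1 ≤ T₀)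
    (hRH : RHUpTo T₀) (k : ℕ) {h c : ℝ}
    (hh : Real.log π + 2 * primeSum (2 * a + 2 * δ) + c ≤ reDigammaQuarter h) :
    verifiedGram g ψ T₀ + c * highMass g ψ - verifiedTariff ψ a δ T₀ h k * weilNorm2Sq g ≤
      (weilQuadratic g).re := by
  have h0 := weilQuadratic_re_ge_verifiedGram_raw hg ha.le hsupp hψ hT₀ hRH k hh
  have hX := weilNorm1_sq_le hg ha hsupp
  have hT₀pos : 0 < T₀ := by linarith
  set D := weilL1 (deriv^[k + 1] (mollC ψ)) with hD
  have hD0 : 0 ≤ D := weilL1_nonneg _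
  have hA₁ := zetaDensityConst_pos
  have hl2 : 0 ≤ Real.log 2 := Real.log_nonneg (by norm_num)
  have hδ := hψ.radius_nonneg
  have heδ : 0 ≤ Real.exp δ - 1 := by linarith [Real.one_le_exp hδ]
  have hc₁ : 0 ≤ 4 * Real.log 2 * zetaDensityConst * Real.exp a * D ^ 2 := by positivity
  have hlow : lowErr g ψ a T₀ k ≤
      8 * Real.log 2 * zetaDensityConst * a * Real.exp a * D ^ 2 / T₀ ^ (2 * k) *
        weilNorm2Sq g := by
    have := mul_le_mul_of_nonneg_left hX hc₁
    calc lowErr g ψ a T₀ k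
        = 4 * Real.log 2 * zetaDensityConst * Real.exp a * D ^ 2 * weilNorm1 g ^ 2 /
            T₀ ^ (2 * k) := by rw [lowErr, hD]; ring
      _ ≤ 4 * Real.log 2 * zetaDensityConst * Real.exp a * D ^ 2 * (2 * a * weilNorm2Sq g) /
            T₀ ^ (2 * k) := div_le_div_of_nonneg_right this (by positivity)
      _ = _ := by ring
  have hpol : 2 * (Real.exp δ - 1) * (Real.exp a * weilNorm1 g ^ 2) ≤
      4 * (Real.exp δ - 1) * a * Real.exp a * weilNorm2Sq g := by
    have hc : 0 ≤ 2 * (Real.exp δ - 1) * Real.exp a := by positivity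
    have := mul_le_mul_of_nonneg_left hX hc
    nlinarith
  unfold verifiedTariff
  rw [← hD]
  nlinarith

/-! ### The reduction: Weil positivity on a window from `RHUpTo T₀` and one RH-free inequality -/

/-- The **near-null sampling hypothesis** `NNS(a; ψ, δ, T₀, h, c, k)`: on the window `[-a, a]`
the positive pair (verified Gram form) + `c` · (high mass) dominates the verified tariff,
`τ ‖g‖₂² ≤ 𝒱(g) + c M₂(g)` for every window test `g`.  RH-free (it involves the zeros of `ζ`
with `|Im ρ| ≤ T₀` only): a quantitative sampling statement for time-limited functions at the
verified ordinates.  A DEFINITION used only as an explicit hypothesis of the reduction below —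
posited, not a fact and not a published result; whether it holds for given data is open
(handoff/prove-1/ATTEMPT-15.md §4). [folklore] -/
def NearNullSampling (a : ℝ) (ψ : ℝ → ℝ) (δ T₀ h c : ℝ) (k : ℕ) : Prop :=
  ∀ g : ℝ → ℂ, IsWeilTest g → tsupport g ⊆ Icc (-a) a →
    verifiedTariff ψ a δ T₀ h k * weilNorm2Sq g ≤ verifiedGram g ψ T₀ + c * highMass g ψ

/-- **The reduction (THEOREM V).** `RHUpTo T₀` (`T₀ ≥ 1`), a mollifier `ψ` of radius `δ`, a height
`h` and margin `c` with `log π + 2 S(2a + 2δ) + c ≤ Re ψ(1/4 + ih/2)`, and `NNS(a; ψ, δ, T₀, h, c, k)`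
together give Weil positivity on the window `[-a, a]`. -/
theorem weilPositivityOn_of_rhUpTo_of_nearNullSampling (ha : 0 < a) (hψ : IsMollifier ψ δ)
    {T₀ : ℝ} (hT₀ : 1 ≤ T₀) (hRH : RHUpTo T₀) (k : ℕ) {h c : ℝ}
    (hh : Real.log π + 2 * primeSum (2 * a + 2 * δ) + c ≤ reDigammaQuarter h)
    (hNNS : NearNullSampling a ψ δ T₀ h c k) : WeilPositivityOn a := by
  intro g hg hsupp
  have h1 := weilQuadratic_re_ge_verifiedGram hg ha hsupp hψ hT₀ hRH k hh
  have h2 := hNNS g hg hsupp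
  linarith

/-- The same from the Platt–Trudgian named fact: `NNS` at `T₀ = 3 000 175 332 800` gives Weil
positivity on the window. -/
theorem weilPositivityOn_of_platt_trudgian_of_nearNullSampling (hPT : platt_trudgian_numerical_rh)
    (ha : 0 < a) (hψ : IsMollifier ψ δ) (k : ℕ) {h c : ℝ}
    (hh : Real.log π + 2 * primeSum (2 * a + 2 * δ) + c ≤ reDigammaQuarter h)
    (hNNS : NearNullSampling a ψ δ 3000175332800 h c k) : WeilPositivityOn a :=
  weilPositivityOn_of_rhUpTo_of_nearNullSampling ha hψ (by norm_num) (rhUpTo_of_platt_trudgian hPT)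
    k hh hNNS

end Summit.RiemannHypothesis.RiemannHypothesis.Theorems
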